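import Literature.NumberTheory.Rogawski1990.CartanObstructionIndicator
import Literature.NumberTheory.Rogawski1990.CartanObstructionGlobal
import Literature.LinearAlgebra.Matrix.AdjoinSingletonSimpleFactors
import Literature.NumberTheory.GaloisRepresentations.HasseNormEtaleInvolutionNormDescent
import HarnessLib

/-!
# The obstruction of a regular stable class of `U(H)` lies in the SUM-ZERO hyperplane: `∑_𝔪 cartanObsFun p 𝔪 = 0`
# (Rogawski 1990, §3.5 Prop. 3.5.2 (c) p. 29; Kottwitz 1986 §9)

Topic `NumberTheory/Rogawski1990`; namespace `Literature.NumberTheory.Rogawski1990`; **THEOREMS ONLY** (no definition, no named fact, no instance,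
no notation, no `sorry`).  Cell `pub/hodgecm-mathlib`, ENGINE T1 (crux H413 = `stmt-HodgeConjecture-24833`), row G6, sub-row R6d (C, part 2) of
`BLUEPRINT-R6dR7-CartanObsHasse.F0P5a-p03g4` (0a35b92f): the theorem that puts the obstruction vector ★ `MatchingAdeleG₂.cartanObsFun` in
★ `cartanObsSubgroup ι = {ε ∣ ∑ ε = 0} = A(T)` — the input of the DEF (D) `MatchingAdeleG₂.cartanObs : 𝒞′_𝐀(γ₀) → A(T)` (`CartanObstructionSubgroup`).
HC_CM is proved only modulo the printed citations until rung 0 closes.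

THE PRINT.  [Rogawski1990, §3.5 Prop. 3.5.2 (c) p. 29]: the image of `H¹(F, T) ≅ ⊕_j K_j^{τ,×} ∕ N K_jˣ` in `⊕_j ℤ∕2` is the sum-zero hyperplane,
because the Cartan cocycle `H⁻¹ H_g` has determinant `N_{L∕F}(det g)`, a norm; [Kottwitz1986, §9].

THE PROOF (all inputs ★).  Each coordinate is the quadratic Artin indicator of the descended idèle `W_𝔪 ∈ 𝕀_{K₀,𝔪}` of the `𝔪`-component of the
adelic Cartan class (★ `cartanObsFun_eq_quadraticArtinIndicator`, (C1)), `= [N_{K₀,𝔪∕L⁺} W_𝔪]_{L⁺,d}` by norm functoriality in degree `[K₀,𝔪 : L⁺] ≤ 3`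
(★ B-p12 `quadraticArtinIndicator_ideleRelNorm`; the degree bound from ★ p08 `finrank_adjoin_singleton_eq_of_charpoly_separable`); the sum is
`[∏_𝔪 N W_𝔪]_{L⁺,d}` (★ `quadraticArtinIndicator_mul`); and `∏_𝔪 N_{K₀,𝔪∕L⁺} W_𝔪 = N_{L∕L⁺} Y` — the DET-READING theorem ★
`GaloisRepresentations.exists_prod_ideleRelNorm_fixedField_eq` (`HasseNormEtaleInvolutionNormDescent`, F0P4-p05∕A-p14∕A-p10 after A-p14 (g18)'s (Ⅰ)
★ `det_eq_prod_norm_map_mk`) — has indicator `0` (★ `quadraticArtinIndicator_ideleRelNorm_self_eq_zero` at `L = L⁺(√d)`).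
ENGINEERING NOTE (for heirs): the descended idèles `W_𝔪` are obtained from the det-reading theorem in its ABSTRACT factor letters
(`exists_descendedIdeles_prod_ideleRelNorm_eq`) BEFORE the factors are specialised to `L[γ₀] ∕ 𝔪` — building them under `letI` families of
quotient-field instances makes unrelated class problems time out.

WHAT IS PROVED.
* §1 helpers: `quadraticArtinIndicator_prod`, `finrank_fixedField_le_of_surjective`, `finrank_real_cartanSubalgebra` (`= 6`), `exists_cm_antifixed`,
  `cartanInvolutionCM_smul` (`τ` is `σ`-semilinear).
* §2 **`MatchingAdeleG₂.cartanObsFun_eq_quadraticArtinIndicator_ideleRelNorm`** — one presented factor: `cartanObsFun p 𝔪 = [N_{K₀∕L⁺} W]_{L⁺, d}`.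
* §3 **`MatchingAdeleG₂.exists_descendedIdeles_prod_ideleRelNorm_eq`** — the det-reading theorem in CM letters, «∃W» form.
* §4 **`MatchingAdeleG₂.sum_cartanObsFun_eq_zero (hH) (hHd) (hreg) [Fintype (cartanIndexCM hH hHd hreg)] (p) : ∑ 𝔪, p.cartanObsFun hH hHd hreg 𝔪 = 0`**
  (F0P5a-p03 (g5) TRUNK WORDS #3: the `Fintype` structure is a BINDER).

## References
* [Rogawski1990] J. D. Rogawski, *Automorphic Representations of Unitary Groups in Three Variables*, Ann. of Math. Stud. 123 (1990), §3.3 p. 22; §3.5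
  Prop. 3.5.2 (c) p. 29; §5.4 p. 72.
* [Kottwitz1986] R. E. Kottwitz, *Stable trace formula: elliptic singular terms*, Math. Ann. 275 (1986), §9.
* [CasselsFrohlichANT1967] Cassels–Fröhlich (eds.), *Algebraic Number Theory* (1967), Ch. VII §5.1 (B), §7.3.
* [NeukirchANT1999] J. Neukirch, *Algebraic Number Theory* (1999), Ch. VI (5.2) (norm functoriality of the Artin map).
* [Lang2002] S. Lang, *Algebra* (2002), Ch. VI §1 Thm. 1.8 (Artin).
-/

set_option autoImplicit false

noncomputable section

open NumberField IsDedekindDomain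
open scoped TensorProduct Matrix MatrixGroups

namespace Literature.NumberTheory.Rogawski1990

open Literature.NumberTheory.Automorphic Literature.NumberTheory.GaloisRepresentations
open Literature.AlgebraicGeometry.ShimuraVarieties (unitaryGroup)

/-! ## §1 Helpers -/

section Helpers

/-- The quadratic Artin indicator of a finite product is the sum of the indicators (★ `quadraticArtinIndicator_mul`).
[cite: CasselsFrohlichANT1967, Ch. VII §5.1 (B)] -/
theorem quadraticArtinIndicator_prod (K : Type) [Field K] [NumberField K] {d : K} (hd0 : d ≠ 0) {ι : Type} (s : Finset ι)
    (f : ι → ideleGroup K) :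
    quadraticArtinIndicator K d (∏ i ∈ s, f i) = ∑ i ∈ s, quadraticArtinIndicator K d (f i) := by
  classical
  induction s using Finset.induction_on with
  | empty => rw [Finset.prod_empty, Finset.sum_empty]; exact quadraticArtinIndicator_of_mem_principalIdeles (one_mem _)
  | insert i s hi ih => rw [Finset.prod_insert hi, Finset.sum_insert hi, quadraticArtinIndicator_mul hd0, ih]

/-- For an `F`-involution `τ ≠ 1` of a field `C` that is an `F`-algebra QUOTIENT of an algebra `B` with `finrank F B ≤ 2 n`: `[C^τ : F] ≤ n`
(`[C : C^τ] = 2`, `[C : F] ≤ [B : F]`). [cite: Lang2002, Ch. VI §1 Thm. 1.8 (Artin)] -/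
theorem finrank_fixedField_le_of_surjective {F B C : Type} [Field F] [CommRing B] [Algebra F B] [Module.Finite F B] [Field C] [Algebra F C]
    [FiniteDimensional F C] (τ : C ≃ₐ[F] C) (hτ : τ * τ = 1) (hτ1 : τ ≠ 1) (π : B →ₐ[F] C) (hπ : Function.Surjective π) {n : ℕ}
    (hB : Module.finrank F B ≤ 2 * n) : Module.finrank F ↥(IntermediateField.fixedField (Subgroup.zpowers τ)) ≤ n := by
  have hC : Module.finrank F C ≤ 2 * n :=
    (LinearMap.finrank_le_finrank_of_surjective (f := π.toLinearMap) hπ).trans hB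
  have htower := Module.finrank_mul_finrank F ↥(IntermediateField.fixedField (Subgroup.zpowers τ)) C
  rw [finrank_fixedField_zpowers_eq_two τ hτ hτ1] at htower
  omega

end Helpers

/-! ## §2 One coordinate, read down to `L⁺` -/

section SumZero

open scoped NumberField.AdeleRing
open Literature.NumberTheory.AdelicBaseChange

variable {L : Type} [Field L] [NumberField L] [IsCMField L] {H : Matrix (Fin 3) (Fin 3) L} {γ₀ : (UnitaryGroup.cmDatum L 3 H).Rational}

/-- `dim_{L⁺} L[γ₀] = 6` for `γ₀` regular (`= [L : L⁺] · dim_L L[γ₀] = 2 · 3`). [cite: Rogawski1990, §3.4 p. 27] -/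
theorem finrank_real_cartanSubalgebra (hreg : IsRegularElt ((γ₀ : unitaryGroup (cmConjRingHom L) H).val : GL (Fin 3) L)) :
    Module.finrank (↥(maximalRealSubfield L)) ↥(cartanSubalgebra γ₀) = 6 := by
  rw [← Module.finrank_mul_finrank (↥(maximalRealSubfield L)) L ↥(cartanSubalgebra γ₀), Algebra.IsQuadraticExtension.finrank_eq_two,
    Literature.LinearAlgebra.Matrix.finrank_adjoin_singleton_eq_of_charpoly_separable _ hreg]

/-- A non-zero anti-fixed `ε ∈ L` (`σ ε = −ε`) with `ε² ∈ L⁺`: the parameter `d = ε²` presenting `L = L⁺(√d)` and every `K_𝔪 = K₀,𝔪(√d)`.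
[cite: Rogawski1990, §3.5 p. 29] -/
theorem exists_cm_antifixed (L : Type) [Field L] [NumberField L] [IsCMField L] :
    ∃ (ε : L) (d : ↥(maximalRealSubfield L)), ε ≠ 0 ∧ cmConjRingHom L ε = -ε ∧ (d : L) = ε * ε ∧ (d : ↥(maximalRealSubfield L)) ≠ 0 := by
  have hex : ∃ ℓ : L, cmConjRingHom L ℓ ≠ ℓ := by
    by_contra h
    apply IsCMField.complexConj_ne_one L
    exact AlgEquiv.ext fun ℓ => not_not.mp (not_exists.mp h ℓ)
  obtain ⟨ε, hε0, hσε⟩ := exists_ne_zero_map_eq_neg (cmConjRingHom L) (IsCMField.complexConj_apply_apply L) hex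
  have hmem : ε * ε ∈ maximalRealSubfield L := by
    rw [← IsCMField.complexConj_eq_self_iff]
    change cmConjRingHom L (ε * ε) = ε * ε
    rw [map_mul, hσε, neg_mul_neg]
  refine ⟨ε, ⟨ε * ε, hmem⟩, hε0, hσε, rfl, fun h => ?_⟩
  have := congrArg Subtype.val h
  exact mul_ne_zero hε0 hε0 this


/-- **One coordinate, read down to `L⁺`**: for a presentation `(C, π, τ_C)` of the τ-stable factor `𝔪` and the descended idèle `W ∈ 𝕀_{C^τ}`
(`con W = Z_π(adelicCartanRepr p)`), `cartanObsFun p 𝔪 = [N_{C^τ∕L⁺} W]_{L⁺, d}` — ★ `cartanObsFun_eq_quadraticArtinIndicator` followed by norm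
functoriality ★ `quadraticArtinIndicator_ideleRelNorm` in degree `[C^τ : L⁺] ≤ 3` (`dim_{L⁺} L[γ₀] = 6`, `[C : C^τ] = 2`).  Single factor, abstract letters: no
instance families. [cite: Rogawski1990, §3.5 Prop. 3.5.2 (c) p. 29] [cite: NeukirchANT1999, Ch. VI (5.2)] -/
theorem MatchingAdeleG₂.cartanObsFun_eq_quadraticArtinIndicator_ideleRelNorm (hH : (H.map (cmConjRingHom L))ᵀ = H) (hHd : IsUnit H.det)
    (hreg : IsRegularElt ((γ₀ : unitaryGroup (cmConjRingHom L) H).val : GL (Fin 3) L)) (p : MatchingAdeleG₂ L H H γ₀)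
    (𝔪 : cartanIndexCM hH hHd hreg) {C : Type} [Field C] [NumberField C] [Algebra (↥(maximalRealSubfield L)) C] (τ : C ≃ₐ[↥(maximalRealSubfield L)] C)
    (π : ↥(cartanSubalgebra γ₀) →ₐ[↥(maximalRealSubfield L)] C) (hτπ : ∀ b, π (cartanInvolutionCM hH hHd hreg b) = τ (π b))
    (hπ : Function.Surjective π) (hker : ∀ b, π b = 0 ↔ b ∈ 𝔪.1.asIdeal)
    [IsGalois (IntermediateField.fixedField (Subgroup.zpowers τ)) C] (hτ : τ * τ = 1) (hτ1 : τ ≠ 1)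
    {ε : L} (hε0 : ε ≠ 0) (hσε : cmConjRingHom L ε = -ε) {d₀ : ↥(maximalRealSubfield L)} (hd₀ : (d₀ : L) = ε * ε)
    (W : (AdeleRing (𝓞 ↥(IntermediateField.fixedField (Subgroup.zpowers τ))) ↥(IntermediateField.fixedField (Subgroup.zpowers τ)))ˣ)
    (hW : AdeleRing.ideleBaseChange (↥(IntermediateField.fixedField (Subgroup.zpowers τ))) C W =
      Units.map ((adeleRingTensorAlgEquiv (↥(maximalRealSubfield L)) C).toAlgHom.comp (Algebra.TensorProduct.map (AlgHom.id (AdeleRing (𝓞 ↥(maximalRealSubfield L)) ↥(maximalRealSubfield L)) (AdeleRing (𝓞 ↥(maximalRealSubfield L)) ↥(maximalRealSubfield L))) π)).toRingHom.toMonoidHom (p.adelicCartanRepr hH hHd hreg)) :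
    p.cartanObsFun hH hHd hreg 𝔪 =
      quadraticArtinIndicator (↥(maximalRealSubfield L)) d₀ (Literature.NumberTheory.AdelicBaseChange.ideleRelNorm (↥(maximalRealSubfield L)) ↥(IntermediateField.fixedField (Subgroup.zpowers τ)) W) := by
  haveI hBfin : Module.Finite (↥(maximalRealSubfield L)) ↥(cartanSubalgebra γ₀) := moduleFinite_cartanSubalgebra γ₀
  haveI : Module.Finite (↥(maximalRealSubfield L)) C := Module.Finite.of_surjective π.toLinearMap hπ
  have hd₀0 : d₀ ≠ 0 := fun h => mul_ne_zero hε0 hε0 (by rw [← hd₀, h]; rfl)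
  -- the anti-fixed unit of the factor: `δ := π θ`, `δ² = d₀`
  have hθ := cartanInvolution_cartanTheta (cmConjRingHom L) (cmConjRingHom_algebraMap L) (IsCMField.complexConj_apply_apply L) hHd hH hreg
    (transpose_map_mul_mul_eq_of_rational γ₀) hε0 hσε
  have hθ' : cartanInvolutionCM hH hHd hreg ((cartanTheta _ ε hε0 : (↥(cartanSubalgebra γ₀))ˣ) : ↥(cartanSubalgebra γ₀)) =
      -((cartanTheta _ ε hε0 : (↥(cartanSubalgebra γ₀))ˣ) : ↥(cartanSubalgebra γ₀)) := hθ
  have hδ : τ (π ((cartanTheta _ ε hε0 : (↥(cartanSubalgebra γ₀))ˣ) : ↥(cartanSubalgebra γ₀))) = -π ((cartanTheta _ ε hε0 : (↥(cartanSubalgebra γ₀))ˣ) : ↥(cartanSubalgebra γ₀)) := by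
    rw [← hτπ, hθ', map_neg]
  have hδ0 : π ((cartanTheta _ ε hε0 : (↥(cartanSubalgebra γ₀))ˣ) : ↥(cartanSubalgebra γ₀)) ≠ 0 := ((cartanTheta _ ε hε0).isUnit.map π).ne_zero
  have hθθ : ((cartanTheta _ ε hε0 : (↥(cartanSubalgebra γ₀))ˣ) : ↥(cartanSubalgebra γ₀)) * ((cartanTheta _ ε hε0 : (↥(cartanSubalgebra γ₀))ˣ) : ↥(cartanSubalgebra γ₀)) = algebraMap (↥(maximalRealSubfield L)) ↥(cartanSubalgebra γ₀) d₀ := by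
    apply Subtype.ext
    rw [Subalgebra.coe_mul, coe_cartanTheta, IsScalarTower.algebraMap_apply (↥(maximalRealSubfield L)) L ↥(cartanSubalgebra γ₀), Subalgebra.coe_algebraMap,
      show algebraMap (↥(maximalRealSubfield L)) L d₀ = (d₀ : L) from rfl, hd₀, Algebra.algebraMap_eq_smul_one, smul_mul_smul_comm, Matrix.mul_one]
  have hd : π ((cartanTheta _ ε hε0 : (↥(cartanSubalgebra γ₀))ˣ) : ↥(cartanSubalgebra γ₀)) * π ((cartanTheta _ ε hε0 : (↥(cartanSubalgebra γ₀))ˣ) : ↥(cartanSubalgebra γ₀)) = algebraMap (↥(maximalRealSubfield L)) C d₀ := by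
    rw [← map_mul, hθθ]; exact π.commutes d₀
  have hfin : Module.finrank (↥(maximalRealSubfield L)) ↥(IntermediateField.fixedField (Subgroup.zpowers τ)) ≤ 3 :=
    finrank_fixedField_le_of_surjective τ hτ hτ1 π hπ (by rw [finrank_real_cartanSubalgebra hreg])
  rw [p.cartanObsFun_eq_quadraticArtinIndicator hH hHd hreg 𝔪 τ π hτπ hπ hker hτ hτ1 hδ hδ0 (mul_self_eq_algebraMap_fixedField τ hd) W hW,
    quadraticArtinIndicator_ideleRelNorm hfin hd₀0]

/-- `τ (ℓ • b) = σ(ℓ) • τ b` for the `H`-adjoint on `L[γ₀]` (★ `hermStar_smul`): `τ` is `σ`-semilinear. [cite: Rogawski1990, §3.5 p. 29] -/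
theorem cartanInvolutionCM_smul (hH : (H.map (cmConjRingHom L))ᵀ = H) (hHd : IsUnit H.det)
    (hreg : IsRegularElt ((γ₀ : unitaryGroup (cmConjRingHom L) H).val : GL (Fin 3) L)) (ℓ : L) (b : ↥(cartanSubalgebra γ₀)) :
    cartanInvolutionCM hH hHd hreg (ℓ • b) = IsCMField.complexConj L ℓ • cartanInvolutionCM hH hHd hreg b :=
  Subtype.ext (by
    rw [Subalgebra.coe_smul, coe_cartanInvolutionCM, coe_cartanInvolutionCM, Subalgebra.coe_smul, hermStar_smul]
    rfl)

/-! ## §3 The det-reading theorem in CM letters («∃W» form) -/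

/-- **THE DESCENDED IDÈLES AND THE NORM OF THEIR PRODUCT** (★ `GaloisRepresentations.exists_prod_ideleRelNorm_fixedField_eq` in CM letters): for a
`τ`-fixed adelic unit `X` of the Cartan algebra with `det Ψ X = D · σD` and ANY presentation `(C i, π i, τC i)` of the τ-stable factors, there are descended
idèles `W i ∈ 𝕀_{K₀ i}` (`con (W i) = Z_i X`) whose norms to `L⁺` multiply to a norm from `L`: `∏ i N_{K₀ i∕L⁺} (W i) = N_{L∕L⁺} Y`.  The `W i` are built
HERE, in the abstract factor letters (★ `smul_unitsMap_eq_self` + ★ (E1) `existsUnique_ideleBaseChange_eq_of_smul_eq`), and the general theorem is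
specialised to `σ := complexConj`, `τ := cartanInvolutionCM` (`cartanInvolutionCM_smul`), `Ψ := adelicCartanGlue` (★ `adelicCartanGlue_tmul`).
[cite: Rogawski1990, §3.5 Prop. 3.5.2 (c) p. 29] [cite: CasselsFrohlichANT1967, Ch. VII §7.3] -/
theorem MatchingAdeleG₂.exists_descendedIdeles_prod_ideleRelNorm_eq (hH : (H.map (cmConjRingHom L))ᵀ = H) (hHd : IsUnit H.det)
    (hreg : IsRegularElt ((γ₀ : unitaryGroup (cmConjRingHom L) H).val : GL (Fin 3) L)) :
    ∀ (X : (adelicCartanAlgebra γ₀)ˣ)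
    (_hX : Algebra.TensorProduct.map (AlgHom.id (AdeleRing (𝓞 ↥(maximalRealSubfield L)) ↥(maximalRealSubfield L)) (AdeleRing (𝓞 ↥(maximalRealSubfield L)) ↥(maximalRealSubfield L))) (cartanInvolutionCM hH hHd hreg : ↥(cartanSubalgebra γ₀) →ₐ[↥(maximalRealSubfield L)] ↥(cartanSubalgebra γ₀)) (X : adelicCartanAlgebra γ₀) = X)
    (D : AdeleRing (𝓞 L) L) (_hD : (adelicCartanGlue (F := ↥(maximalRealSubfield L)) (cartanSubalgebra γ₀) (X : adelicCartanAlgebra γ₀)).det = D * adeleConj L D)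
    (ι : Type) [Fintype ι] (e : ι ≃ cartanIndexCM hH hHd hreg)
    (C : ι → Type) [∀ i, Field (C i)] [∀ i, NumberField (C i)] [∀ i, Algebra (↥(maximalRealSubfield L)) (C i)]
    (π : ∀ i, ↥(cartanSubalgebra γ₀) →ₐ[↥(maximalRealSubfield L)] C i) (_hπ : ∀ i, Function.Surjective (π i)) (_hker : ∀ i b, π i b = 0 ↔ b ∈ (e i).1.asIdeal)
    (τC : ∀ i, C i ≃ₐ[↥(maximalRealSubfield L)] C i) (_hτπ : ∀ i b, π i (cartanInvolutionCM hH hHd hreg b) = τC i (π i b))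
    [∀ i, IsGalois (↥(IntermediateField.fixedField (Subgroup.zpowers (τC i)))) (C i)],
    ∃ (W : ∀ i, (AdeleRing (𝓞 ↥(IntermediateField.fixedField (Subgroup.zpowers (τC i)))) ↥(IntermediateField.fixedField (Subgroup.zpowers (τC i))))ˣ),
      (∀ i, AdeleRing.ideleBaseChange (↥(IntermediateField.fixedField (Subgroup.zpowers (τC i)))) (C i) (W i) =
        Units.map ((adeleRingTensorAlgEquiv (↥(maximalRealSubfield L)) (C i)).toAlgHom.comp (Algebra.TensorProduct.map (AlgHom.id (AdeleRing (𝓞 ↥(maximalRealSubfield L)) ↥(maximalRealSubfield L)) (AdeleRing (𝓞 ↥(maximalRealSubfield L)) ↥(maximalRealSubfield L))) (π i))).toRingHom.toMonoidHom X) ∧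
      ∃ Y : (AdeleRing (𝓞 L) L)ˣ, ∏ i, Literature.NumberTheory.AdelicBaseChange.ideleRelNorm (↥(maximalRealSubfield L)) (↥(IntermediateField.fixedField (Subgroup.zpowers (τC i)))) (W i) =
        Literature.NumberTheory.AdelicBaseChange.ideleRelNorm (↥(maximalRealSubfield L)) L Y := by
  intro X hX D hD ι _ e C _ _ _ π hπ hker τC hτπ _
  have hYfix := fun i => smul_unitsMap_eq_self (cartanInvolutionCM hH hHd hreg) (π i) (τC i) (hτπ i) hX
  have hW := fun i => (existsUnique_ideleBaseChange_eq_of_smul_eq (τC i) (hYfix i)).exists.choose_spec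
  refine ⟨fun i => (existsUnique_ideleBaseChange_eq_of_smul_eq (τC i) (hYfix i)).exists.choose, hW, ?_⟩
  have hσ : IsCMField.complexConj L * IsCMField.complexConj L = 1 := AlgEquiv.ext fun x => IsCMField.complexConj_apply_apply L x
  exact exists_prod_ideleRelNorm_fixedField_eq (IsCMField.complexConj L) hσ (IsCMField.complexConj_ne_one L) (adeleConj L) (adeleConj_apply L) hreg
    (cartanInvolutionCM hH hHd hreg)
    (cartanInvolution_cartanInvolution (cmConjRingHom L) (cmConjRingHom_algebraMap L) (IsCMField.complexConj_apply_apply L) hHd hH hreg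
      (transpose_map_mul_mul_eq_of_rational γ₀))
    (cartanInvolutionCM_smul hH hHd hreg) (adelicCartanGlue (F := ↥(maximalRealSubfield L)) (cartanSubalgebra γ₀)) (adelicCartanGlue_tmul _) X hX
    (by rw [hD, mul_comm]) e C π hπ hker τC hτπ _ hW

/-! ## §4 The sum-zero theorem -/

/-- **`∑_𝔪 cartanObsFun p 𝔪 = 0` — the obstruction vector lies in the sum-zero hyperplane `A(T)`** [Rogawski1990, Prop. 3.5.2 (c): the image of
`H¹(F,T)` in `⊕_j ℤ∕2` is the sum-zero hyperplane because `det(H⁻¹ H_g) = N(det g)` is a norm]: each coordinate is the quadratic Artin indicator of the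
descended idèle `W_𝔪` (★ `cartanObsFun_eq_quadraticArtinIndicator`), equal to `[N_{K₀,𝔪∕L⁺} W_𝔪]_{L⁺, d}` by norm functoriality in degree `≤ 3`
(★ `quadraticArtinIndicator_ideleRelNorm`), the sum is `[∏_𝔪 N W_𝔪]_{L⁺,d}` (★ `_mul`), and `∏_𝔪 N W_𝔪 = N_{L∕L⁺} Y` (★ det-reading,
`exists_descendedIdeles_prod_ideleRelNorm_eq`) has indicator `0` (★ `quadraticArtinIndicator_ideleRelNorm_self_eq_zero`).  The `Fintype` structure on
`ι = cartanIndexCM` is a BINDER (F0P5a-p03 (g5) TRUNK WORDS #3); consumers supply `Fintype.ofFinite` from ★ `finite_cartanIndex`.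
[cite: Rogawski1990, §3.5 Prop. 3.5.2 (c) p. 29; §3.3 p. 22] [cite: Kottwitz1986, §9] -/
theorem MatchingAdeleG₂.sum_cartanObsFun_eq_zero (hH : (H.map (cmConjRingHom L))ᵀ = H) (hHd : IsUnit H.det)
    (hreg : IsRegularElt ((γ₀ : unitaryGroup (cmConjRingHom L) H).val : GL (Fin 3) L)) [Fintype (cartanIndexCM hH hHd hreg)]
    (p : MatchingAdeleG₂ L H H γ₀) :
    ∑ 𝔪 : cartanIndexCM hH hHd hreg, p.cartanObsFun hH hHd hreg 𝔪 = 0 := by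
  classical
  -- CM data
  obtain ⟨ε, d₀, hε0, hσε, hd₀, hd₀0⟩ := exists_cm_antifixed L
  have h2 : (2 : L) ≠ 0 := two_ne_zero
  have hex : ∃ ℓ : L, cmConjRingHom L ℓ ≠ ℓ := ⟨ε, by
    rw [hσε]; exact fun h => hε0 (add_self_eq_zero.mp (neg_eq_iff_add_eq_zero.mp h))⟩
  -- the determinant of the Cartan class is `D · σD`, `D := det g(p)` (computed BEFORE the factor instances enter the context)
  obtain ⟨gd, hgd⟩ : ∃ gd : AdeleRing (𝓞 L) L, gd = (((p.adelicConjugator hreg : GL (Fin 3) (AdeleRing (𝓞 L) L)) : Matrix (Fin 3) (Fin 3) (AdeleRing (𝓞 L) L)).det) := ⟨_, rfl⟩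
  have hX := p.map_cartanInvolutionCM_adelicCartanRepr hH hHd hreg
  have hD : (adelicCartanGlue (F := ↥(maximalRealSubfield L)) (cartanSubalgebra γ₀) ((p.adelicCartanRepr hH hHd hreg : (adelicCartanAlgebra γ₀)ˣ) : adelicCartanAlgebra γ₀)).det =
      gd * adeleConj L gd := by
    rw [p.adelicCartanGlue_adelicCartanRepr hH hHd hreg, det_adelicCartan hHd, mul_comm, hgd]
  -- the factor families live only inside `key`
  have key : ∃ N : cartanIndexCM hH hHd hreg → ideleGroup (↥(maximalRealSubfield L)),
      (∀ 𝔪, p.cartanObsFun hH hHd hreg 𝔪 = quadraticArtinIndicator (↥(maximalRealSubfield L)) d₀ (N 𝔪)) ∧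
      ∃ Y : (AdeleRing (𝓞 L) L)ˣ, ∏ 𝔪, N 𝔪 = Literature.NumberTheory.AdelicBaseChange.ideleRelNorm (↥(maximalRealSubfield L)) L Y := by
    haveI hBfin : Module.Finite (↥(maximalRealSubfield L)) ↥(cartanSubalgebra γ₀) := moduleFinite_cartanSubalgebra γ₀
    letI instField : ∀ 𝔪 : cartanIndexCM hH hHd hreg, Field (↥(cartanSubalgebra γ₀) ⧸ 𝔪.1.asIdeal) := fun 𝔪 => @Ideal.Quotient.field _ _ 𝔪.1.asIdeal 𝔪.1.isMaximal
    haveI instFin : ∀ 𝔪 : cartanIndexCM hH hHd hreg, Module.Finite (↥(maximalRealSubfield L)) (↥(cartanSubalgebra γ₀) ⧸ 𝔪.1.asIdeal) := fun 𝔪 =>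
      Module.Finite.of_surjective (Ideal.Quotient.mkₐ (↥(maximalRealSubfield L)) 𝔪.1.asIdeal).toLinearMap (Ideal.Quotient.mkₐ_surjective (↥(maximalRealSubfield L)) 𝔪.1.asIdeal)
    haveI instNF : ∀ 𝔪 : cartanIndexCM hH hHd hreg, NumberField (↥(cartanSubalgebra γ₀) ⧸ 𝔪.1.asIdeal) := fun 𝔪 => NumberField.of_module_finite (↥(maximalRealSubfield L)) _
    let τC : ∀ 𝔪 : cartanIndexCM hH hHd hreg, (↥(cartanSubalgebra γ₀) ⧸ 𝔪.1.asIdeal) ≃ₐ[↥(maximalRealSubfield L)] (↥(cartanSubalgebra γ₀) ⧸ 𝔪.1.asIdeal) := fun 𝔪 =>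
      cartanResidueInvolution (cmConjRingHom L) (cmConjRingHom_algebraMap L) (IsCMField.complexConj_apply_apply L) hHd hH hreg
        (transpose_map_mul_mul_eq_of_rational γ₀) 𝔪
    have hτCmk : ∀ (𝔪 : cartanIndexCM hH hHd hreg) (b : ↥(cartanSubalgebra γ₀)),
        Ideal.Quotient.mkₐ (↥(maximalRealSubfield L)) 𝔪.1.asIdeal (cartanInvolutionCM hH hHd hreg b) = τC 𝔪 (Ideal.Quotient.mkₐ (↥(maximalRealSubfield L)) 𝔪.1.asIdeal b) := fun 𝔪 b =>
      (cartanResidueInvolution_mk (cmConjRingHom L) (cmConjRingHom_algebraMap L) (IsCMField.complexConj_apply_apply L) hHd hH hreg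
        (transpose_map_mul_mul_eq_of_rational γ₀) 𝔪 b).symm
    have hτC2 : ∀ 𝔪 : cartanIndexCM hH hHd hreg, τC 𝔪 * τC 𝔪 = 1 := fun 𝔪 => AlgEquiv.ext fun c =>
      cartanResidueInvolution_cartanResidueInvolution (cmConjRingHom L) (cmConjRingHom_algebraMap L) (IsCMField.complexConj_apply_apply L) hHd hH hreg
        (transpose_map_mul_mul_eq_of_rational γ₀) 𝔪 c
    have hτC1 : ∀ 𝔪 : cartanIndexCM hH hHd hreg, τC 𝔪 ≠ 1 := fun 𝔪 =>
      cartanResidueInvolution_ne_one (cmConjRingHom L) (cmConjRingHom_algebraMap L) (IsCMField.complexConj_apply_apply L) hHd hH hreg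
        (transpose_map_mul_mul_eq_of_rational γ₀) h2 hex 𝔪
    haveI instGal : ∀ 𝔪 : cartanIndexCM hH hHd hreg, IsGalois (↥(IntermediateField.fixedField (Subgroup.zpowers (τC 𝔪)))) (↥(cartanSubalgebra γ₀) ⧸ 𝔪.1.asIdeal) :=
      fun 𝔪 => isGalois_fixedField_zpowers (τC 𝔪)
    -- the det-reading step: the product of the norms of the descended idèles is a norm from `L`
    letI instAlg : ∀ 𝔪 : cartanIndexCM hH hHd hreg, Algebra (↥(maximalRealSubfield L)) (↥(cartanSubalgebra γ₀) ⧸ 𝔪.1.asIdeal) := fun 𝔪 => inferInstance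
    obtain ⟨W, hW, Y, hY⟩ := MatchingAdeleG₂.exists_descendedIdeles_prod_ideleRelNorm_eq hH hHd hreg (p.adelicCartanRepr hH hHd hreg) hX gd hD (cartanIndexCM hH hHd hreg) (Equiv.refl _)
      (fun 𝔪 => ↥(cartanSubalgebra γ₀) ⧸ 𝔪.1.asIdeal) (fun 𝔪 => Ideal.Quotient.mkₐ (↥(maximalRealSubfield L)) 𝔪.1.asIdeal)
      (fun 𝔪 => Ideal.Quotient.mkₐ_surjective (↥(maximalRealSubfield L)) 𝔪.1.asIdeal) (fun 𝔪 b => Ideal.Quotient.eq_zero_iff_mem) τC hτCmk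
    -- each coordinate, read down to `L⁺` (single-factor lemma)
    have hcoord := fun 𝔪 : cartanIndexCM hH hHd hreg =>
      p.cartanObsFun_eq_quadraticArtinIndicator_ideleRelNorm hH hHd hreg 𝔪 (τC 𝔪) (Ideal.Quotient.mkₐ (↥(maximalRealSubfield L)) 𝔪.1.asIdeal) (hτCmk 𝔪)
        (Ideal.Quotient.mkₐ_surjective (↥(maximalRealSubfield L)) 𝔪.1.asIdeal) (fun b => Ideal.Quotient.eq_zero_iff_mem) (hτC2 𝔪) (hτC1 𝔪) hε0 hσε hd₀ (W 𝔪) (hW 𝔪)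
    exact ⟨fun 𝔪 => Literature.NumberTheory.AdelicBaseChange.ideleRelNorm (↥(maximalRealSubfield L)) _ (W 𝔪), hcoord, Y, hY⟩
  obtain ⟨N, hN, Y, hY⟩ := key
  -- sum = indicator of the product = indicator of a norm from `L` = 0
  rw [Finset.sum_congr rfl fun 𝔪 _ => hN 𝔪, ← quadraticArtinIndicator_prod (↥(maximalRealSubfield L)) hd₀0, hY, ← automorphic_ideleRelNorm_eq]
  exact quadraticArtinIndicator_ideleRelNorm_self_eq_zero (IsCMField.complexConj L) hσε hε0
    (show ε * ε = algebraMap (↥(maximalRealSubfield L)) L d₀ from hd₀.symm) Y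

end SumZero

end Literature.NumberTheory.Rogawski1990

end
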